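import Mathlib
import HarnessLib

/-!
# SpectralPin, lattice bookkeeping: from `LevelTwoSolitude`-shaped data to rates, gaps and coefficients
(route `SAWTowerCount`, support item stmt-CriticalPhenomena-7259 `SpectralPin`; helper, `--supports`).

Elementary conversions used to feed the strip transfer-spectrum data of a (gapped)
`LevelTwoSolitude`-type representation `Z_n(ℓ;i,j) ≈ ∑_k e_k u_k(i)u_k(j) λ_k^ℓ` into the abstract
exponential-fitting files (`…SpectralPinBounds`, `…SpectralPinLimit`):
* scaled rates `ψ = −n log λ₀`, relative gaps `g_k = n(log λ₀ − log λ_k)` and the window/gap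
  inequalities in that language (`rate_nonneg`, `rate_lt_of_lt`, `rate_le_of_le`, `le_rate_of_le`);
* `λ_k^ℓ = e^{−(ψ+g_k)·ℓ/n}` and the tail `(λ₀e^{−9π/4n})^ℓ = e^{−(ψ+9π/4)ℓ/n}` (`rep_conv`);
* floors: bulk rows `⌊yn⌋ ∈ [n/4, 3n/4]` for `y ∈ [1/3,1/2]`, `n ≤ ⌊mn⌋₊` for `m ≥ 1`,
  `⌊jn⌋₊/n = j`, `⌊mn⌋₊/n → m`.
Mathlib only; no cited facts.
-/

noncomputable section

namespace Summit.CriticalPhenomena.SAWScalingLimit.Theorems.SpectralPin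

open Filter Topology Finset

/-! ### Rates and gaps -/

/-- `log (λ₀ e^{x}) = log λ₀ + x`. -/
theorem log_mul_exp {lam0 x : ℝ} (h0 : 0 < lam0) :
    Real.log (lam0 * Real.exp x) = Real.log lam0 + x := by
  rw [Real.log_mul h0.ne' (Real.exp_pos x).ne', Real.log_exp]

/-- `λ_k ≤ λ₀` gives a nonnegative relative gap. -/
theorem rate_nonneg {n lam0 lamk : ℝ} (hn : 0 < n) (hk : 0 < lamk) (h : lamk ≤ lam0) :
    0 ≤ n * (Real.log lam0 - Real.log lamk) :=
  mul_nonneg hn.le (sub_nonneg.mpr (Real.log_le_log hk h))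

/-- `λ₀ e^{−θπ/n} < λ_k` gives relative gap `< θπ`. -/
theorem rate_lt_of_lt {n lam0 lamk θ : ℝ} (hn : 0 < n) (h0 : 0 < lam0)
    (h : lam0 * Real.exp (-θ * Real.pi / n) < lamk) :
    n * (Real.log lam0 - Real.log lamk) < θ * Real.pi := by
  have h1 := Real.log_lt_log (mul_pos h0 (Real.exp_pos _)) h
  rw [log_mul_exp h0] at h1
  have h2 : Real.log lam0 - Real.log lamk < θ * Real.pi / n := by
    have : -θ * Real.pi / n = -(θ * Real.pi / n) := by ring
    linarith [this]
  calc n * (Real.log lam0 - Real.log lamk) < n * (θ * Real.pi / n) :=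
        mul_lt_mul_of_pos_left h2 hn
    _ = θ * Real.pi := by field_simp

/-- `λ₀ e^{−θπ/n} ≤ λ_k` gives relative gap `≤ θπ`. -/
theorem rate_le_of_le {n lam0 lamk θ : ℝ} (hn : 0 < n) (h0 : 0 < lam0)
    (h : lam0 * Real.exp (-θ * Real.pi / n) ≤ lamk) :
    n * (Real.log lam0 - Real.log lamk) ≤ θ * Real.pi := by
  have h1 := Real.log_le_log (mul_pos h0 (Real.exp_pos _)) h
  rw [log_mul_exp h0] at h1
  have h2 : Real.log lam0 - Real.log lamk ≤ θ * Real.pi / n := by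
    have : -θ * Real.pi / n = -(θ * Real.pi / n) := by ring
    linarith [this]
  calc n * (Real.log lam0 - Real.log lamk) ≤ n * (θ * Real.pi / n) :=
        mul_le_mul_of_nonneg_left h2 hn.le
    _ = θ * Real.pi := by field_simp

/-- `λ_k ≤ λ₀ e^{−θπ/n}` gives relative gap `≥ θπ`. -/
theorem le_rate_of_le {n lam0 lamk θ : ℝ} (hn : 0 < n) (hk : 0 < lamk)
    (h : lamk ≤ lam0 * Real.exp (-θ * Real.pi / n)) :
    θ * Real.pi ≤ n * (Real.log lam0 - Real.log lamk) := by
  have h0 : 0 < lam0 := by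
    by_contra hneg
    push Not at hneg
    have : lam0 * Real.exp (-θ * Real.pi / n) ≤ 0 :=
      mul_nonpos_of_nonpos_of_nonneg hneg (Real.exp_pos _).le
    linarith
  have h1 := Real.log_le_log hk h
  rw [log_mul_exp h0] at h1
  have h2 : θ * Real.pi / n ≤ Real.log lam0 - Real.log lamk := by
    have : -θ * Real.pi / n = -(θ * Real.pi / n) := by ring
    linarith [this]
  calc θ * Real.pi = n * (θ * Real.pi / n) := by field_simp
    _ ≤ n * (Real.log lam0 - Real.log lamk) := mul_le_mul_of_nonneg_left h2 hn.le

/-- `λ^ℓ = e^{−(ψ + g)·(ℓ/n)}` with `ψ = −n log λ₀`, `g = n (log λ₀ − log λ)`. -/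
theorem pow_eq_exp_rate {n lam0 lam : ℝ} (hn : n ≠ 0) (hk : 0 < lam) (ℓ : ℕ) :
    lam ^ ℓ = Real.exp (-((-n * Real.log lam0 + n * (Real.log lam0 - Real.log lam)) * (ℓ / n))) := by
  have : -((-n * Real.log lam0 + n * (Real.log lam0 - Real.log lam)) * (ℓ / n)) = ℓ * Real.log lam := by
    field_simp; ring
  rw [this, Real.exp_nat_mul, Real.exp_log hk]

/-- `(λ₀ e^{−9π/4n})^ℓ = e^{−(ψ + 9π/4)·(ℓ/n)}` with `ψ = −n log λ₀`. -/
theorem tail_pow_eq_exp_rate {n lam0 : ℝ} (hn : n ≠ 0) (h0 : 0 < lam0) (ℓ : ℕ) :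
    (lam0 * Real.exp (-(9 / 4) * Real.pi / n)) ^ ℓ =
      Real.exp (-((-n * Real.log lam0 + 9 / 4 * Real.pi) * (ℓ / n))) := by
  have : -((-n * Real.log lam0 + 9 / 4 * Real.pi) * (ℓ / n)) =
      ℓ * (Real.log lam0 + -(9 / 4) * Real.pi / n) := by
    field_simp; ring
  rw [this, Real.exp_nat_mul, Real.exp_add, Real.exp_log h0]

/-- **Representation conversion.** The `LevelTwoSolitude` tail clause at `(n, ℓ, i, j)`, multiplied
by the scaling normalisation `A`, in the rate/coefficient language of the abstract files:
rates `ψ + g_k`, coefficients `c_k = e_k u_k(i)u_k(j)/(u₀(i)u₀(j))` padded by `0` (and gaps padded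
by an arbitrary value `gpad`) beyond `K`, depth `τ = ℓ/n`, amplitude `a = A u₀(i)u₀(j)`. -/
theorem rep_conv (n : ℝ) (ℓ K Kmax : ℕ) (hn : 0 < n) (hK : K ≤ Kmax) (A C₀ Zv gpad : ℝ) (hA : 0 < A)
    (lam e ui uj : ℕ → ℝ) (hlam : ∀ k ≤ K, 0 < lam k) (hui : 0 < ui 0) (huj : 0 < uj 0)
    (h : |Zv - ∑ k ∈ Finset.range (K + 1), e k * ui k * uj k * lam k ^ ℓ| ≤
      C₀ * (ui 0 * uj 0) * (lam 0 * Real.exp (-(9 / 4) * Real.pi / n)) ^ ℓ) :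
    |A * Zv - A * ui 0 * uj 0 * ∑ k ∈ Finset.range (Kmax + 1),
        (if k ≤ K then e k * ui k * uj k / (ui 0 * uj 0) else 0) *
          Real.exp (-((-n * Real.log (lam 0) +
            (if k ≤ K then n * (Real.log (lam 0) - Real.log (lam k)) else gpad)) * (ℓ / n)))| ≤
      C₀ * (A * ui 0 * uj 0) * Real.exp (-((-n * Real.log (lam 0) + 9 / 4 * Real.pi) * (ℓ / n))) := by
  have hn0 : n ≠ 0 := hn.ne'
  have hu0 : ui 0 * uj 0 ≠ 0 := (mul_pos hui huj).ne'
  -- the padded sum equals the original one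
  have hsum : A * ui 0 * uj 0 * ∑ k ∈ Finset.range (Kmax + 1),
      (if k ≤ K then e k * ui k * uj k / (ui 0 * uj 0) else 0) *
        Real.exp (-((-n * Real.log (lam 0) +
          (if k ≤ K then n * (Real.log (lam 0) - Real.log (lam k)) else gpad)) * (ℓ / n))) =
      A * ∑ k ∈ Finset.range (K + 1), e k * ui k * uj k * lam k ^ ℓ := by
    have hsub : Finset.range (K + 1) ⊆ Finset.range (Kmax + 1) :=
      Finset.range_subset_range.mpr (Nat.succ_le_succ hK)
    rw [← Finset.sum_subset hsub]
    · rw [Finset.mul_sum, Finset.mul_sum]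
      refine Finset.sum_congr rfl fun k hk => ?_
      have hkK : k ≤ K := Nat.lt_succ_iff.mp (Finset.mem_range.mp hk)
      rw [if_pos hkK, if_pos hkK, ← pow_eq_exp_rate hn0 (hlam k hkK) ℓ]
      field_simp
    · intro k _ hk
      have hkK : ¬ k ≤ K := fun h => hk (Finset.mem_range.mpr (Nat.lt_succ_of_le h))
      rw [if_neg hkK, zero_mul]
  rw [hsum, ← tail_pow_eq_exp_rate hn0 (hlam 0 (Nat.zero_le K)) ℓ, ← mul_sub, abs_mul, abs_of_pos hA]
  calc A * |Zv - ∑ k ∈ Finset.range (K + 1), e k * ui k * uj k * lam k ^ ℓ|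
      ≤ A * (C₀ * (ui 0 * uj 0) * (lam 0 * Real.exp (-(9 / 4) * Real.pi / n)) ^ ℓ) :=
        mul_le_mul_of_nonneg_left h hA.le
    _ = C₀ * (A * ui 0 * uj 0) * (lam 0 * Real.exp (-(9 / 4) * Real.pi / n)) ^ ℓ := by ring

/-- The product `a·c_k = A e_k u_k(i) u_k(j)` (the rank-one numerator), for `k ≤ K`. -/
theorem ac_eq (A e uki ukj u0i u0j : ℝ) (hu : u0i * u0j ≠ 0) :
    A * u0i * u0j * (e * uki * ukj / (u0i * u0j)) = A * e * uki * ukj := by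
  have h1 : u0i ≠ 0 := left_ne_zero_of_mul hu
  have h2 : u0j ≠ 0 := right_ne_zero_of_mul hu
  field_simp

/-- `|c_k| ≤ C₀` from `|u_k(i)u_k(j)| ≤ C₀ u₀(i)u₀(j)` and `e_k² = 1`. -/
theorem abs_coeff_le (e uki ukj u0i u0j C₀ : ℝ) (he : e ^ 2 = 1) (hu : 0 < u0i * u0j)
    (h : |uki * ukj| ≤ C₀ * (u0i * u0j)) : |e * uki * ukj / (u0i * u0j)| ≤ C₀ := by
  have he' : |e| = 1 := by
    have : |e| ^ 2 = 1 := by rw [sq_abs, he]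
    nlinarith [abs_nonneg e]
  rw [abs_div, abs_of_pos hu, div_le_iff₀ hu, mul_assoc, abs_mul, he', one_mul]
  exact h

/-! ### Floors -/

/-- Bulk rows: for `y ∈ [1/3, 1/2]` and `n ≥ 12`, `⌊yn⌋ ∈ [n/4, 3n/4]`. -/
theorem floor_row_mem {y : ℝ} (hy1 : 1 / 3 ≤ y) (hy2 : y ≤ 1 / 2) {n : ℕ} (hn : 12 ≤ n) :
    (1 / 4 : ℝ) * n ≤ (⌊y * n⌋ : ℤ) ∧ ((⌊y * n⌋ : ℤ) : ℝ) ≤ (1 - 1 / 4) * n := by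
  have hn' : (12 : ℝ) ≤ n := by exact_mod_cast hn
  constructor
  · have := Int.lt_floor_add_one (y * n)
    nlinarith
  · have := Int.floor_le (y * n)
    nlinarith

/-- For `m ≥ 1`, `n ≤ ⌊mn⌋₊`. -/
theorem le_natFloor_mul {m : ℝ} (hm : 1 ≤ m) (n : ℕ) : n ≤ ⌊m * n⌋₊ := by
  refine Nat.le_floor ?_
  have : (0 : ℝ) ≤ n := Nat.cast_nonneg n
  nlinarith

/-- `⌊j n⌋₊ / n = j` for naturals `j` and `n ≥ 1`. -/
theorem natFloor_natCast_mul_div {n : ℕ} (hn : 1 ≤ n) (j : ℕ) :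
    ((⌊(j : ℝ) * n⌋₊ : ℕ) : ℝ) / n = j := by
  have : (j : ℝ) * n = ((j * n : ℕ) : ℝ) := by push_cast; ring
  rw [this, Nat.floor_natCast]
  have hn' : (n : ℝ) ≠ 0 := by exact_mod_cast (Nat.one_le_iff_ne_zero.mp hn)
  push_cast
  field_simp

/-- `⌊mn⌋₊ / n → m` for `m ≥ 0`. -/
theorem tendsto_natFloor_mul_div {m : ℝ} (hm : 0 ≤ m) :
    Tendsto (fun n : ℕ => ((⌊m * n⌋₊ : ℕ) : ℝ) / n) atTop (𝓝 m) :=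
  (tendsto_nat_floor_mul_div_atTop hm).comp tendsto_natCast_atTop_atTop

end Summit.CriticalPhenomena.SAWScalingLimit.Theorems.SpectralPin
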